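import Summits.BirchSwinnertonDyer.BirchSwinnertonDyer.Theorems.EisensteinPrimesGoodLatticeKatzMeasureReflectFrame
import HarnessLib

set_option linter.dupNamespace false
set_option autoImplicit false

/-!
# de Shalit II.6.4 ON THE PERIOD AXIS: the functional-equation relation TRANSPORTS between period triples, hence «II.6.4 for ONE pair
# of frames at ONE triple ⟹ the typed conclusion for EVERY frame at EVERY triple» — the «∀ ⟸ ∃» certificate on the period axis for
# `DeShalit1987.thmII64_katzMeasure₂_functionalEquation` (every imaginary quadratic `K`, every split `p`)

Cell `bsd-eis`, width seat `bsd-line-x1-p1-w2` gen 32; `--supports stmt-BirchSwinnertonDyer-19032` (crux 2, line `halves`; helper).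
File 7 (last) of the thmII64 certificates.  THEOREMS ONLY (no `def`, no named fact, no `sorry`).
* §8 `avatarValueAt_eq_onePlusPow_mul_onePlusPow` — **the two-variable `onePlusPow` formula**: a character `r` through the topological
  pair satisfies `r(σ) = (1+X)^{κ₁σ}(1+Y)^{κ₂σ}` at `(X, Y) = (r(γ₁) − 1, r(γ₂) − 1)` for EVERY `σ ∈ Γ_K` (de Shalit II.4.17 (54); the
  pair map is a quotient map onto `ℤ_p²`, both sides are continuous in the coordinates and agree on `ℕ²`).
  `relation_transport` — **the relation "`G(P r) = C·r(g)·Ǧ(P r₂)` for all conjugate-inverse pairs" passes from `(G, Ǧ)` to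
  `(U·G, C(C κ₀)·U·Ǧ)` with constants `(C/κ₀, h·g)`**, `h ∈ Γ_K` the element with pair coordinates
  `(x + d₁₁x + d₂₁w, d₁₂x + w + d₂₂w)` (`(x, w)` the exponents of `U`, `(d_{i1}, d_{i2})` the coordinates of `cγᵢc⁻¹`): the unit's
  values satisfy `U(P r) = r(h)·U(P r₂)` by group-likeness of `(1+X)^c` (file 4) and §8.
* §9 `thmII64_conclusion_at_every_period_of_exists` (+ `_of_isUnitGeneratorPair`) — **THE PERIOD-AXIS CERTIFICATE**: if at ONE
  period triple there are a non-zero `λ`-frame `G₀`, a `λ̌`-frame `Ǧ₀`, a unit `C` and `g` with de Shalit's relation (print: II.6.4 (i)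
  for THE pair of measures in their own normalisation), then at EVERY period triple and for EVERY `λ`-frame `G'` there, the conclusion
  of the typed fact holds (`Ǧ'` from file 6, constants from `relation_transport`).

UPSHOT for crux 2's by-name closure (p763736 / p768473).  With files 1–2 (uniqueness at fixed data) and this certificate, the typed
∀-frame / ∀-period / ∀-unit-pair `DeShalit1987.thmII64_katzMeasure₂_functionalEquation` says no more than: (print) II.6.4 (i) for
the measures at ONE normalisation in each coordinate system, plus (print, II.4.12–4.14) the measure is not identically zero.  The
generator-pair axis is print-faithful outright ("fix an isomorphism `κᵢ`", II.4.17).  7/7 of the PUBLISHED by-name inputs of the crux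
are now ∃-shaped or kernel-certified.  HONEST FRAMING: helper theorems; nothing here proves a summit statement, the crux, a stub,
BSD, or a theorem of de Shalit / Katz / Rubin; 0 cells / labels / tiers move.

References: [deShalit1987] II.4.17 (54), II.6.1 (2), II.6.4 (i) (9), (13)–(15); [Gouvea1993PadicNumbers] §5.9.
-/

noncomputable section

open scoped NumberField Classical Topology
open Filter NumberField IsDedekindDomain Field
open Literature Literature.NumberTheory.GaloisRepresentations Literature.NumberTheory.EllipticCurves
open Literature.NumberTheory.EllipticCurves.DeShalit1987
open Summit.BirchSwinnertonDyer.Rank1Residual.X11b Summit.BirchSwinnertonDyer.Rank1Residual.X11b.LambdaSupply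
open Summit.BirchSwinnertonDyer.Rank1Residual.X11b.Three.LambdaSupply
open Summit.BirchSwinnertonDyer.BirchSwinnertonDyer.Theorems.GoodLatticeKatzMeasureUniqueness
open Summit.BirchSwinnertonDyer.BirchSwinnertonDyer.Theorems.GoodLatticeKatzMeasureUniquenessBinders
open Summit.BirchSwinnertonDyer.BirchSwinnertonDyer.Theorems.GoodLatticeKatzMeasurePeriodRigidity
open Summit.BirchSwinnertonDyer.BirchSwinnertonDyer.Theorems.GoodLatticeKatzMeasureRigidityUnitValues
open Summit.BirchSwinnertonDyer.BirchSwinnertonDyer.Theorems.GoodLatticeKatzMeasureReflectTransport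
open Summit.BirchSwinnertonDyer.BirchSwinnertonDyer.Theorems.GoodLatticeKatzMeasureReflectFrame

namespace Summit.BirchSwinnertonDyer.BirchSwinnertonDyer.Theorems.GoodLatticeThmII64PeriodAxis

variable {p : ℕ} [Fact p.Prime] {K : Type} [Field K] [NumberField K]

/-! ### §8 The two-variable `onePlusPow` formula for characters through the pair, and TRANSPORT OF THE RELATION -/

/-- **A character through the `ℤ_p²`-tower is `(1+T₁)^{κ₁σ}(1+T₂)^{κ₂σ}` at its own point**: for `r` through the topological
pair `(κ₁, κ₂; γ₁, γ₂)` and every `σ ∈ Γ_K`, `r(σ) = onePlusPow (κ₁σ) (r(γ₁) − 1) · onePlusPow (κ₂σ) (r(γ₂) − 1)` (`r` is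
constant on the fibres of the pair map, which is a quotient map onto `ℤ_p²`; both sides are continuous in the coordinates and
agree on `ℕ²`). de Shalit II.4.17 (54) "`L(χκ₁^{−s₁}κ₂^{−s₂}) = G(χ; u^{s₁} − 1, u^{s₂} − 1)`".
[cite: deShalit1987, II.4.17 (54) (store chunk 78)] [cite: Washington1997, §13.1] -/
theorem avatarValueAt_eq_onePlusPow_mul_onePlusPow {κ₁ κ₂ : ZpExtension K p} {γ₁ γ₂ : absoluteGaloisGroup K}
    (hpair : ZpExtension.IsTopGeneratorPair κ₁ κ₂ γ₁ γ₂) {r : FramedGaloisRep K (PadicAlgCl p) 1}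
    (hr : FactorsThroughPair κ₁ κ₂ r) (σ : absoluteGaloisGroup K) :
    avatarValueAt r σ =
      IntSeries.onePlusPow (Multiplicative.toAdd (κ₁ σ)) (avatarValueAt r γ₁ - 1) *
        IntSeries.onePlusPow (Multiplicative.toAdd (κ₂ σ)) (avatarValueAt r γ₂ - 1) := by
  set q := fun σ : absoluteGaloisGroup K ↦ (Multiplicative.toAdd (κ₁ σ), Multiplicative.toAdd (κ₂ σ)) with hq
  have hqc : Continuous q :=
    (continuous_toAdd.comp (map_continuous κ₁)).prodMk (continuous_toAdd.comp (map_continuous κ₂))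
  have hqs : Function.Surjective q := surjective_pairMap hpair
  -- `r` is constant on the fibres of `q`
  have hfib : ∀ σ τ : absoluteGaloisGroup K, q σ = q τ → avatarValueAt r σ = avatarValueAt r τ := by
    intro σ τ hστ
    simp only [hq, Prod.mk.injEq] at hστ
    have hk₁ : κ₁ (τ⁻¹ * σ) = 1 := by
      rw [map_mul, map_inv, ← ofAdd_toAdd (κ₁ σ), ← ofAdd_toAdd (κ₁ τ), hστ.1, inv_mul_cancel]
    have hk₂ : κ₂ (τ⁻¹ * σ) = 1 := by
      rw [map_mul, map_inv, ← ofAdd_toAdd (κ₂ σ), ← ofAdd_toAdd (κ₂ τ), hστ.2, inv_mul_cancel]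
    have h1 : avatarValueAt r (τ⁻¹ * σ) = 1 := by rw [avatarValueAt, hr _ hk₁ hk₂]; simp
    rw [← mul_inv_cancel_left τ σ, avatarValueAt_mul, h1, mul_one]
  -- the induced function on `ℤ_p²` and its continuity
  set rbar : ℤ_[p] × ℤ_[p] → ℂ_[p] := fun c ↦ avatarValueAt r (Function.surjInv hqs c) with hrbar
  have hrq : ∀ σ, rbar (q σ) = avatarValueAt r σ := fun σ ↦ hfib _ _ (Function.surjInv_eq hqs (q σ))
  have hquot : Topology.IsQuotientMap q := hqc.isClosedMap.isQuotientMap hqc hqs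
  have hrc : Continuous rbar := by
    rw [hquot.continuous_iff, show rbar ∘ q = fun σ ↦ avatarValueAt r σ from funext fun σ ↦ hrq σ]
    exact continuous_avatarValueAt r
  have hX : ‖avatarValueAt r γ₁ - 1‖ < 1 := norm_avatarValueAt_sub_one_lt_of_factorsThroughPair hr γ₁
  have hY : ‖avatarValueAt r γ₂ - 1‖ < 1 := norm_avatarValueAt_sub_one_lt_of_factorsThroughPair hr γ₂
  set Φ : ℤ_[p] × ℤ_[p] → ℂ_[p] := fun c ↦
    IntSeries.onePlusPow c.1 (avatarValueAt r γ₁ - 1) * IntSeries.onePlusPow c.2 (avatarValueAt r γ₂ - 1) with hΦ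
  have hΦc : Continuous Φ :=
    ((IntSeries.continuous_onePlusPow hX).comp continuous_fst).mul ((IntSeries.continuous_onePlusPow hY).comp continuous_snd)
  have hclosed : IsClosed {c : ℤ_[p] × ℤ_[p] | rbar c = Φ c} := isClosed_eq hrc hΦc
  have h11 : Multiplicative.toAdd (κ₁ γ₁) = 1 := by rw [hpair.left]; rfl
  have h21 : Multiplicative.toAdd (κ₂ γ₁) = 0 := by rw [hpair.apply_left]; rfl
  have h12 : Multiplicative.toAdd (κ₁ γ₂) = 0 := by rw [hpair.apply_right]; rfl
  have h22 : Multiplicative.toAdd (κ₂ γ₂) = 1 := by rw [hpair.right]; rfl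
  have hnat : ∀ n m : ℕ, q (γ₁ ^ n * γ₂ ^ m) = ((n : ℤ_[p]), (m : ℤ_[p])) := by
    intro n m
    simp only [hq, map_mul, map_pow, toAdd_mul, toAdd_pow, h11, h21, h12, h22, nsmul_eq_mul, smul_zero,
      mul_one, add_zero, zero_add]
  have hnatval : ∀ n m : ℕ, rbar ((n : ℤ_[p]), (m : ℤ_[p])) = Φ ((n : ℤ_[p]), (m : ℤ_[p])) := by
    intro n m
    have h1 : rbar ((n : ℤ_[p]), (m : ℤ_[p])) = avatarValueAt r (γ₁ ^ n * γ₂ ^ m) := by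
      rw [← hnat n m]; exact hrq _
    rw [h1, avatarValueAt_mul, RamifiedSevenEllipticUnits.LemmaXi.avatarValueAt_pow,
      RamifiedSevenEllipticUnits.LemmaXi.avatarValueAt_pow, hΦ]
    show _ = IntSeries.onePlusPow (n : ℤ_[p]) (avatarValueAt r γ₁ - 1) * IntSeries.onePlusPow (m : ℤ_[p]) (avatarValueAt r γ₂ - 1)
    rw [IntSeries.onePlusPow_natCast, IntSeries.onePlusPow_natCast, add_sub_cancel, add_sub_cancel]
  have step1 : ∀ (m : ℕ) (a : ℤ_[p]), rbar (a, (m : ℤ_[p])) = Φ (a, (m : ℤ_[p])) := fun m a ↦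
    PadicInt.denseRange_natCast.induction_on (p := fun a : ℤ_[p] ↦ rbar (a, (m : ℤ_[p])) = Φ (a, (m : ℤ_[p]))) a
      (hclosed.preimage (continuous_id.prodMk continuous_const)) (fun n ↦ hnatval n m)
  have hall : ∀ a b : ℤ_[p], rbar (a, b) = Φ (a, b) := fun a b ↦
    PadicInt.denseRange_natCast.induction_on (p := fun b : ℤ_[p] ↦ rbar (a, b) = Φ (a, b)) b
      (hclosed.preimage (continuous_const.prodMk continuous_id)) (fun m ↦ step1 m a)
  rw [← hrq σ]
  exact hall _ _

/-- **TRANSPORT OF THE FUNCTIONAL-EQUATION RELATION ALONG THE PERIOD AXIS.**  `K` imaginary quadratic, `p = v v̄` split, `λ`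
of type `(k, j)` unramified off `S ∪ {v̄}`, topological pair, `G ≠ 0`, `G'` frames of `λ` at two period triples and `U` with
`G' = U·G` (file 3); `c` a lift of complex conjugation NOT in `Γ_K`.  If the relation of de Shalit II.6.4 holds for `(G, Ǧ)` with
constants `(C, g)` — "`G(P r) = C·r(g)·Ǧ(P r₂)` for all conjugate-inverse pairs `(r, r₂)` through the tower" — then it holds for
`(U·G, C(C κ₀)·U·Ǧ)` with constants `(C/κ₀, h·g)` for an `h ∈ Γ_K` depending only on `U` and the pair: the unit's values satisfy
`U(P r) = U(P r₂)·r(h)` (`r₂(γᵢ) = r(c γᵢ c⁻¹)⁻¹`; §1 group-likeness; §8 two-variable formula; `surjective_pairMap` for `h`).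
[cite: deShalit1987, II.6.4 Theorem (i) (9), (13)–(15) (store chunk 84–85), II.4.17 (54)] -/
theorem relation_transport (hK : IsImaginaryQuadratic K)
    {ι : PadicAlgCl p ≃+* ℂ} {v vbar : HeightOneSpectrum (𝓞 K)}
    (hv : ((p : ℕ) : 𝓞 K) ∈ v.asIdeal) (hvbar : ((p : ℕ) : 𝓞 K) ∈ vbar.asIdeal) (hne : vbar ≠ v)
    (hι : ∀ (w : InfinitePlace K) (d : 𝓞 K), d ∈ v.asIdeal ↔ ‖ι.symm (w.embedding (d : K))‖ < 1)
    {S : Finset (HeightOneSpectrum (𝓞 K))} {lam : HeckeCharacter K} {kl jl : ℤ}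
    (hlam : lam.HasInfinityType (fun _ ↦ kl) (fun _ ↦ jl))
    (hlamu : ∀ w : HeightOneSpectrum (𝓞 K), w ∉ S → w ≠ vbar → lam.IsUnramifiedAt w)
    {κ₁ κ₂ : ZpExtension K p} {γ₁ γ₂ : absoluteGaloisGroup K}
    (hpair : ZpExtension.IsTopGeneratorPair κ₁ κ₂ γ₁ γ₂)
    {Ω δ Ω' δ' : ℂ} {Ωp Ωp' : ℂ_[p]} {G G' U Gc : PowerSeries (PowerSeries (PadicComplexInt p))}
    (hG : IsKatzMeasure₂ ι v vbar S κ₁ κ₂ γ₁ γ₂ lam Ω δ Ωp G)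
    (hG' : IsKatzMeasure₂ ι v vbar S κ₁ κ₂ γ₁ γ₂ lam Ω' δ' Ωp' G')
    (hΩ : Ω ≠ 0) (hδ : δ ≠ 0) (hΩp : Ωp ≠ 0) (hΩ' : Ω' ≠ 0) (hδ' : δ' ≠ 0) (hΩp' : Ωp' ≠ 0)
    (hG0 : G ≠ 0) (hU : G' = U * G)
    (κ₀ : PadicComplexInt p) (hκ₀ : ‖(κ₀ : ℂ_[p])‖ = 1) {C : ℂ_[p]} {g : absoluteGaloisGroup K}
    (hrel : ∀ (r r₂ : FramedGaloisRep K (PadicAlgCl p) 1),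
      FactorsThroughPair κ₁ κ₂ r → FactorsThroughPair κ₁ κ₂ r₂ → IsConjInverse r r₂ →
      ∀ x : ℂ_[p],
        IntSeries.HasValueAt₂ Gc (avatarValueAt r₂ γ₁ - 1) (avatarValueAt r₂ γ₂ - 1) x →
        IntSeries.HasValueAt₂ G (avatarValueAt r γ₁ - 1) (avatarValueAt r γ₂ - 1) (C * avatarValueAt r g * x)) :
    ∃ h : absoluteGaloisGroup K,
      ∀ (r r₂ : FramedGaloisRep K (PadicAlgCl p) 1),
        FactorsThroughPair κ₁ κ₂ r → FactorsThroughPair κ₁ κ₂ r₂ → IsConjInverse r r₂ →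
        ∀ x : ℂ_[p],
          IntSeries.HasValueAt₂ (PowerSeries.C (PowerSeries.C κ₀) * U * Gc)
              (avatarValueAt r₂ γ₁ - 1) (avatarValueAt r₂ γ₂ - 1) x →
          IntSeries.HasValueAt₂ (U * G) (avatarValueAt r γ₁ - 1) (avatarValueAt r γ₂ - 1)
            (C * (κ₀ : ℂ_[p])⁻¹ * avatarValueAt r (h * g) * x) := by
  haveI : Algebra.IsQuadraticExtension ℚ K := ⟨hK.1⟩
  haveI : IsGalois ℚ K := inferInstance
  haveI : IsTotallyComplex K := hK.2
  have himag : ∀ w : InfinitePlace K, w.IsComplex := fun w ↦ hK.2.isComplex w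
  -- a lift of complex conjugation and its outer action `θ` (an involution)
  obtain ⟨c, hc, hc2⟩ := exists_not_mem_range_absGaloisRestrict (K := ℚ) (L := K) (Rat.castHom ℝ) himag
  set θ := absGaloisOuterConj ℚ K c with hθ
  have hθθ : ∀ σ, θ (θ σ) = σ := fun σ ↦ by
    rw [hθ, ← absGaloisOuterConj_mul_apply, hc2, absGaloisOuterConj_one_apply]
  have hθres : ∀ σ, absGaloisRestrict ℚ K (θ σ) = c * absGaloisRestrict ℚ K σ * c⁻¹ :=
    fun σ ↦ absGaloisRestrict_absGaloisOuterConj ℚ K c σ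
  -- the explicit shape of `U` through one listing twist
  obtain ⟨η, ψ, n, hn, he, heκ, hηu, hηt⟩ := exists_listing_twist hK ι hpair (kl.natAbs + jl.natAbs)
  obtain ⟨a, b, hba, ha, hb⟩ := exists_listed_type (le_refl (kl.natAbs + jl.natAbs)) hn
  have hlamη : (lam * η).HasInfinityType (fun _ ↦ -(a : ℤ)) (fun _ ↦ (b : ℤ)) := by
    have h := hlam.mul' hηt
    have e1 : ((fun _ ↦ kl : InfinitePlace K → ℤ) + fun _ ↦ -((2 * n : ℕ) : ℤ)) = fun _ ↦ -(a : ℤ) := by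
      funext w'
      simp only [Pi.add_apply, ha]
      ring
    have e2 : ((fun _ ↦ jl : InfinitePlace K → ℤ) + fun _ ↦ (n : ℤ)) = fun _ ↦ (b : ℤ) := by
      funext w'
      simp only [Pi.add_apply, hb]
    exact Eq.mp (congrArg₂ (fun f g ↦ (lam * η).HasInfinityType f g) e1 e2) h
  obtain ⟨c₀, x, w, s₁, s₂, hs₁, hs₂, -, -, -, -, hEq⟩ := exists_eq_unitTwist₂_mul_of_listing_twist hK hv hvbar
    hne hι hlamu hpair he heκ (fun w _ ↦ hηu w) hba hlamη hG hG' hΩ hδ hΩp hΩ' hδ' hΩp' hG0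
  have hUeq : U = IntSeries.unitTwist₂ (PowerSeries.C (PowerSeries.C c₀) *
      (PowerSeries.map (PowerSeries.C (R := PadicComplexInt p)) (IntSeries.binomPow x) *
        PowerSeries.C (IntSeries.binomPow w))) s₁ s₂ :=
    mul_right_cancel₀ hG0 (hU.symm.trans hEq)
  have V : ∀ {X Y : ℂ_[p]}, ‖X‖ < 1 → ‖Y‖ < 1 → IntSeries.HasValueAt₂ U X Y
      ((c₀ : ℂ_[p]) * (IntSeries.onePlusPow x ((s₁ : ℂ_[p]) * (1 + X) - 1) *
        IntSeries.onePlusPow w ((s₂ : ℂ_[p]) * (1 + Y) - 1))) := by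
    intro X Y hX hY
    rw [hUeq]
    exact hasValueAt₂_twistedUnit hs₁ hs₂ hX hY
  -- the coordinates of `θ γ₁`, `θ γ₂`, and the element `h`
  set d₁₁ := Multiplicative.toAdd (κ₁ (θ γ₁)) with hd₁₁
  set d₁₂ := Multiplicative.toAdd (κ₂ (θ γ₁)) with hd₁₂
  set d₂₁ := Multiplicative.toAdd (κ₁ (θ γ₂)) with hd₂₁
  set d₂₂ := Multiplicative.toAdd (κ₂ (θ γ₂)) with hd₂₂
  set X₁ : ℤ_[p] := x + d₁₁ * x + d₂₁ * w with hX₁def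
  set X₂ : ℤ_[p] := d₁₂ * x + w + d₂₂ * w with hX₂def
  obtain ⟨h, hh⟩ := surjective_pairMap hpair (X₁, X₂)
  simp only [Prod.mk.injEq] at hh
  refine ⟨h, fun r r₂ hr hr₂ hci xval hGc' ↦ ?_⟩
  have hX : ‖avatarValueAt r γ₁ - 1‖ < 1 := norm_avatarValueAt_sub_one_lt_of_factorsThroughPair hr γ₁
  have hY : ‖avatarValueAt r γ₂ - 1‖ < 1 := norm_avatarValueAt_sub_one_lt_of_factorsThroughPair hr γ₂
  have hX₂ : ‖avatarValueAt r₂ γ₁ - 1‖ < 1 := norm_avatarValueAt_sub_one_lt_of_factorsThroughPair hr₂ γ₁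
  have hY₂ : ‖avatarValueAt r₂ γ₂ - 1‖ < 1 := norm_avatarValueAt_sub_one_lt_of_factorsThroughPair hr₂ γ₂
  have hconj : ∀ i : absoluteGaloisGroup K, r₂ i = (r (θ i))⁻¹ := fun i ↦ by
    refine hci (θ i) i c hc ?_
    rw [← hθres (θ i), hθθ]
  have hval₂ : ∀ i : absoluteGaloisGroup K, avatarValueAt r₂ i = (avatarValueAt r (θ i))⁻¹ := fun i ↦ by
    have h1 : r₂ i = r (θ i)⁻¹ := by rw [hconj i, map_inv]
    have h2 : avatarValueAt r₂ i = avatarValueAt r (θ i)⁻¹ := by simp only [avatarValueAt, h1]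
    rw [h2]
    exact eq_inv_of_mul_eq_one_left (by rw [← avatarValueAt_mul, inv_mul_cancel, avatarValueAt_one])
  set X := avatarValueAt r γ₁ - 1 with hXdef
  set Y := avatarValueAt r γ₂ - 1 with hYdef
  have hrγ₁ : avatarValueAt r γ₁ = 1 + X := by rw [hXdef]; ring
  have hrγ₂ : avatarValueAt r γ₂ = 1 + Y := by rw [hYdef]; ring
  -- the two-variable formula at `θ γ₁`, `θ γ₂`, `h`
  have hT₁ : avatarValueAt r (θ γ₁) = IntSeries.onePlusPow d₁₁ X * IntSeries.onePlusPow d₁₂ Y :=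
    avatarValueAt_eq_onePlusPow_mul_onePlusPow hpair hr (θ γ₁)
  have hT₂ : avatarValueAt r (θ γ₂) = IntSeries.onePlusPow d₂₁ X * IntSeries.onePlusPow d₂₂ Y :=
    avatarValueAt_eq_onePlusPow_mul_onePlusPow hpair hr (θ γ₂)
  have hrh : avatarValueAt r h = IntSeries.onePlusPow X₁ X * IntSeries.onePlusPow X₂ Y := by
    rw [avatarValueAt_eq_onePlusPow_mul_onePlusPow hpair hr h, hh.1, hh.2]
  have hP : ∀ (a : ℤ_[p]) {z : ℂ_[p]}, ‖z‖ < 1 → ‖IntSeries.onePlusPow a z - 1‖ < 1 :=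
    fun a z hz ↦ IntSeries.norm_onePlusPow_sub_one_lt a hz
  have hP0 : ∀ (a : ℤ_[p]) {z : ℂ_[p]}, ‖z‖ < 1 → IntSeries.onePlusPow a z ≠ 0 :=
    fun a z hz ↦ IntSeries.onePlusPow_ne_zero a hz
  have Vr := V hX hY
  have Vr₂ := V hX₂ hY₂
  -- expand `U(P r)`: `onePlusPow x (s₁(1+X) − 1) = onePlusPow x (s₁ − 1) · onePlusPow x X`
  have e₁ : IntSeries.onePlusPow x ((s₁ : ℂ_[p]) * (1 + X) - 1) =
      IntSeries.onePlusPow x ((s₁ : ℂ_[p]) - 1) * IntSeries.onePlusPow x X := by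
    have h := onePlusPow_mul_base x hs₁ (b := 1 + X) (by rwa [add_sub_cancel_left])
    rwa [add_sub_cancel_left] at h
  have e₂ : IntSeries.onePlusPow w ((s₂ : ℂ_[p]) * (1 + Y) - 1) =
      IntSeries.onePlusPow w ((s₂ : ℂ_[p]) - 1) * IntSeries.onePlusPow w Y := by
    have h := onePlusPow_mul_base w hs₂ (b := 1 + Y) (by rwa [add_sub_cancel_left])
    rwa [add_sub_cancel_left] at h
  -- expand `U(P r₂)`: `r₂(γᵢ) = r(θγᵢ)⁻¹`
  have hr₂γ₁ : avatarValueAt r₂ γ₁ = (IntSeries.onePlusPow d₁₁ X * IntSeries.onePlusPow d₁₂ Y)⁻¹ := by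
    rw [hval₂, hT₁]
  have hr₂γ₂ : avatarValueAt r₂ γ₂ = (IntSeries.onePlusPow d₂₁ X * IntSeries.onePlusPow d₂₂ Y)⁻¹ := by
    rw [hval₂, hT₂]
  -- `onePlusPow x (T⁻¹ − 1) = (onePlusPow x (T − 1))⁻¹` for a principal unit `T`
  have hinv : ∀ (a : ℤ_[p]) {T : ℂ_[p]}, ‖T - 1‖ < 1 →
      IntSeries.onePlusPow a (T⁻¹ - 1) = (IntSeries.onePlusPow a (T - 1))⁻¹ := by
    intro a T hT
    have hT1 : ‖T‖ = 1 := R1.norm_eq_one_of_norm_sub_one_lt hT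
    have hT0 : T ≠ 0 := fun h0 ↦ by rw [h0, norm_zero] at hT1; exact zero_ne_one hT1
    have hTi : ‖T⁻¹ - 1‖ < 1 := IwasawaTwoVariable.norm_inv_sub_one_lt hT
    have h := onePlusPow_mul_base a hTi hT
    rw [inv_mul_cancel₀ hT0, sub_self, IntSeries.onePlusPow_at_zero] at h
    exact eq_inv_of_mul_eq_one_left h.symm
  -- `onePlusPow a (onePlusPow d X · onePlusPow d' Y − 1) = onePlusPow (d a) X · onePlusPow (d' a) Y`
  have hcomp : ∀ (a d d' : ℤ_[p]),
      IntSeries.onePlusPow a (IntSeries.onePlusPow d X * IntSeries.onePlusPow d' Y - 1) =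
        IntSeries.onePlusPow (d * a) X * IntSeries.onePlusPow (d' * a) Y := by
    intro a d d'
    rw [onePlusPow_mul_base a (hP d hX) (hP d' hY), ← IntSeries.onePlusPow_mul d a hX, ← IntSeries.onePlusPow_mul d' a hY]
  have hT₁u : ‖IntSeries.onePlusPow d₁₁ X * IntSeries.onePlusPow d₁₂ Y - 1‖ < 1 := norm_mul_sub_one_lt (hP _ hX) (hP _ hY)
  have hT₂u : ‖IntSeries.onePlusPow d₂₁ X * IntSeries.onePlusPow d₂₂ Y - 1‖ < 1 := norm_mul_sub_one_lt (hP _ hX) (hP _ hY)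
  have f₁ : IntSeries.onePlusPow x ((s₁ : ℂ_[p]) * (1 + (avatarValueAt r₂ γ₁ - 1)) - 1) =
      IntSeries.onePlusPow x ((s₁ : ℂ_[p]) - 1) *
        (IntSeries.onePlusPow (d₁₁ * x) X * IntSeries.onePlusPow (d₁₂ * x) Y)⁻¹ := by
    rw [add_sub_cancel, hr₂γ₁, onePlusPow_mul_base x hs₁ (IwasawaTwoVariable.norm_inv_sub_one_lt hT₁u), hinv x hT₁u,
      hcomp x d₁₁ d₁₂]
  have f₂ : IntSeries.onePlusPow w ((s₂ : ℂ_[p]) * (1 + (avatarValueAt r₂ γ₂ - 1)) - 1) =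
      IntSeries.onePlusPow w ((s₂ : ℂ_[p]) - 1) *
        (IntSeries.onePlusPow (d₂₁ * w) X * IntSeries.onePlusPow (d₂₂ * w) Y)⁻¹ := by
    rw [add_sub_cancel, hr₂γ₂, onePlusPow_mul_base w hs₂ (IwasawaTwoVariable.norm_inv_sub_one_lt hT₂u), hinv w hT₂u,
      hcomp w d₂₁ d₂₂]
  rw [f₁, f₂] at Vr₂
  rw [e₁, e₂] at Vr
  have hrh' : avatarValueAt r h = (IntSeries.onePlusPow x X * IntSeries.onePlusPow (d₁₁ * x) X * IntSeries.onePlusPow (d₂₁ * w) X) *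
      (IntSeries.onePlusPow (d₁₂ * x) Y * IntSeries.onePlusPow w Y * IntSeries.onePlusPow (d₂₂ * w) Y) := by
    rw [hrh, hX₁def, hX₂def, IntSeries.onePlusPow_add _ _ hX, IntSeries.onePlusPow_add _ _ hX, IntSeries.onePlusPow_add _ _ hY,
      IntSeries.onePlusPow_add _ _ hY]
  -- decompose the given value `xval` of `C(C κ₀)·U·Ǧ` at `P r₂`
  obtain ⟨y, hy⟩ := CycTangentCMCycTangentBoundPowerCharacters.exists_hasValueAt₂ Gc hX₂ hY₂
  have hκval := PrintCf2.RubinValueTwoReadout.hasValueAt₂_mul hX₂ hY₂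
    (PrintCf2.RubinValueTwoReadout.hasValueAt₂_mul hX₂ hY₂ (hasValueAt₂_C (IntSeries.hasValueAt_C κ₀ _)) Vr₂) hy
  have hxval : xval = _ := hGc'.unique hκval
  -- the old relation at `y`, and the new left-hand side
  have hold := hrel r r₂ hr hr₂ hci y hy
  have hnewval := PrintCf2.RubinValueTwoReadout.hasValueAt₂_mul hX hY Vr hold
  rw [hxval]
  convert hnewval using 1
  have hκ0 : (κ₀ : ℂ_[p]) ≠ 0 := fun h0 ↦ by rw [h0, norm_zero] at hκ₀; exact zero_ne_one hκ₀
  rw [avatarValueAt_mul, hrh']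
  have n1 := hP0 x hX
  have n2 := hP0 (d₁₁ * x) hX
  have n3 := hP0 (d₂₁ * w) hX
  have n4 := hP0 (d₁₂ * x) hY
  have n5 := hP0 w hY
  have n6 := hP0 (d₂₂ * w) hY
  field_simp

/-! ### §9 THE PERIOD-AXIS CERTIFICATE: de Shalit II.6.4 for ONE pair of frames at ONE period triple ⟹ for EVERY frame at EVERY triple -/

/-- **«∀ ⟸ ∃» ON THE PERIOD AXIS for `DeShalit1987.thmII64_katzMeasure₂_functionalEquation`.**  `K` imaginary quadratic (any class
number), `p = v v̄` any split prime, `v̄ ∉ S`, `λ` of type `(k, j)` unramified off `S`, a topological generator pair.  Suppose that at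
ONE period triple `(Ω, δ, Ω_p)` there are a NON-ZERO `λ`-frame `G₀`, a `λ̌`-frame `Ǧ₀` (at `c • S`), a unit `C` and `g ∈ Γ_K` with de
Shalit's relation "`G₀(P r) = C·r(g)·Ǧ₀(P r₂)` for all conjugate-inverse pairs `(r, r₂)` through the tower" (print: II.6.4 (i) for THE
pair of measures `μ(𝔣𝔭̄^∞)`, `μ(𝔣̄𝔭̄^∞)` in their own normalisation).  Then at EVERY period triple `(Ω', δ', Ω_p')` (six non-zero period
quantities) and for EVERY `λ`-frame `G'` there, the conclusion of the typed fact holds: there are a `λ̌`-frame `Ǧ'`, a unit `C'` and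
`g'` with the same relation.  (`G' = U·G₀`, file 3; `Ǧ' = C(C κ₀)·U·Ǧ₀` is a `λ̌`-frame, §7; the relation transports with
`C' = C/κ₀`, `g' = h·g`, §8.)  Together with files 1–2 (uniqueness at fixed data) this certifies that the ∀-frame/∀-period phrasing
of the named fact says no more than print plus the non-vanishing of the measure, for topological generator pairs.
[cite: deShalit1987, II.6.4 Theorem (i) (9), (13)–(15) (store chunk 84–85), II.4.12 Remarks (iii)–(iv), II.4.17 (51)–(54)] -/
theorem thmII64_conclusion_at_every_period_of_exists [IsCMField K] (hK : IsImaginaryQuadratic K)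
    {ι : PadicAlgCl p ≃+* ℂ} {v vbar : HeightOneSpectrum (𝓞 K)}
    (hv : ((p : ℕ) : 𝓞 K) ∈ v.asIdeal) (hvbar : ((p : ℕ) : 𝓞 K) ∈ vbar.asIdeal) (hne : vbar ≠ v)
    (hι : ∀ (w : InfinitePlace K) (d : 𝓞 K), d ∈ v.asIdeal ↔ ‖ι.symm (w.embedding (d : K))‖ < 1)
    {S : Finset (HeightOneSpectrum (𝓞 K))} (hvbS : vbar ∉ S) {lam : HeckeCharacter K} {kl jl : ℤ}
    (hlam : lam.HasInfinityType (fun _ ↦ kl) (fun _ ↦ jl))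
    (hlamS : ∀ w : HeightOneSpectrum (𝓞 K), w ∉ S → lam.IsUnramifiedAt w)
    {κ₁ κ₂ : ZpExtension K p} {γ₁ γ₂ : absoluteGaloisGroup K}
    (hpair : ZpExtension.IsTopGeneratorPair κ₁ κ₂ γ₁ γ₂)
    {Ω δ Ω' δ' : ℂ} {Ωp Ωp' : ℂ_[p]}
    (hΩ : Ω ≠ 0) (hδ : δ ≠ 0) (hΩp : Ωp ≠ 0) (hΩ' : Ω' ≠ 0) (hδ' : δ' ≠ 0) (hΩp' : Ωp' ≠ 0)
    (hex : ∃ (G₀ Gc₀ : PowerSeries (PowerSeries (PadicComplexInt p))) (C : ℂ_[p]) (g : absoluteGaloisGroup K),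
      G₀ ≠ 0 ∧ IsKatzMeasure₂ ι v vbar S κ₁ κ₂ γ₁ γ₂ lam Ω δ Ωp G₀ ∧
      IsKatzMeasure₂ ι v vbar (S.image fun w ↦ IsCMField.complexConj K • w) κ₁ κ₂ γ₁ γ₂ (reflect lam) Ω δ Ωp Gc₀ ∧
      ‖C‖ = 1 ∧
      ∀ (r r₂ : FramedGaloisRep K (PadicAlgCl p) 1),
        FactorsThroughPair κ₁ κ₂ r → FactorsThroughPair κ₁ κ₂ r₂ → IsConjInverse r r₂ →
        ∀ x : ℂ_[p],
          IntSeries.HasValueAt₂ Gc₀ (avatarValueAt r₂ γ₁ - 1) (avatarValueAt r₂ γ₂ - 1) x →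
          IntSeries.HasValueAt₂ G₀ (avatarValueAt r γ₁ - 1) (avatarValueAt r γ₂ - 1) (C * avatarValueAt r g * x))
    {G' : PowerSeries (PowerSeries (PadicComplexInt p))}
    (hG' : IsKatzMeasure₂ ι v vbar S κ₁ κ₂ γ₁ γ₂ lam Ω' δ' Ωp' G') :
    ∃ (Gc' : PowerSeries (PowerSeries (PadicComplexInt p))) (C' : ℂ_[p]) (g' : absoluteGaloisGroup K),
      IsKatzMeasure₂ ι v vbar (S.image fun w ↦ IsCMField.complexConj K • w) κ₁ κ₂ γ₁ γ₂ (reflect lam) Ω' δ' Ωp' Gc' ∧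
      ‖C'‖ = 1 ∧
      ∀ (r r₂ : FramedGaloisRep K (PadicAlgCl p) 1),
        FactorsThroughPair κ₁ κ₂ r → FactorsThroughPair κ₁ κ₂ r₂ → IsConjInverse r r₂ →
        ∀ x : ℂ_[p],
          IntSeries.HasValueAt₂ Gc' (avatarValueAt r₂ γ₁ - 1) (avatarValueAt r₂ γ₂ - 1) x →
          IntSeries.HasValueAt₂ G' (avatarValueAt r γ₁ - 1) (avatarValueAt r γ₂ - 1) (C' * avatarValueAt r g' * x) := by
  obtain ⟨G₀, Gc₀, C, g, hG0, hG₀, hGc₀, hC, hrel⟩ := hex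
  have hlamu : ∀ w : HeightOneSpectrum (𝓞 K), w ∉ S → w ≠ vbar → lam.IsUnramifiedAt w := fun w hw _ ↦ hlamS w hw
  -- the unit `U` with `G' = U · G₀`
  obtain ⟨U, -, hU⟩ := exists_isUnit_eq_mul_of_hasInfinityType hK hv hvbar hne hι hlam hlamu hpair.isUnitGeneratorPair
    hG₀ hG' hΩ hδ hΩp hΩ' hδ' hΩp' hG0
  -- the reflected frame at the new triple
  obtain ⟨κ₀, hκ₀, hGc'⟩ := reflectFrame_transport hK hv hvbar hne hι hvbS hlam hlamS hpair hG₀ hG' hΩ hδ hΩp hΩ' hδ' hΩp'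
    hG0 hU hGc₀
  -- the relation transports
  obtain ⟨h, hrel'⟩ := relation_transport hK hv hvbar hne hι hlam hlamu hpair hG₀ hG' hΩ hδ hΩp hΩ' hδ' hΩp' hG0 hU κ₀ hκ₀ hrel
  refine ⟨_, C * (κ₀ : ℂ_[p])⁻¹, h * g, hGc', ?_, ?_⟩
  · rw [norm_mul, norm_inv, hC, hκ₀, inv_one, mul_one]
  · intro r r₂ hr hr₂ hci x hx
    rw [hU]
    exact hrel' r r₂ hr hr₂ hci x hx

/-- **The same for UNIT generator pairs** (the coordinates of `thmII64_katzMeasure₂_functionalEquation`; frames and the tower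
condition do not see unit twists of `κ₁, κ₂`). [cite: deShalit1987, II.6.4 Theorem (i) (store chunk 84–85), II.4.17 (51)–(54)] -/
theorem thmII64_conclusion_at_every_period_of_exists_of_isUnitGeneratorPair [IsCMField K] (hK : IsImaginaryQuadratic K)
    {ι : PadicAlgCl p ≃+* ℂ} {v vbar : HeightOneSpectrum (𝓞 K)}
    (hv : ((p : ℕ) : 𝓞 K) ∈ v.asIdeal) (hvbar : ((p : ℕ) : 𝓞 K) ∈ vbar.asIdeal) (hne : vbar ≠ v)
    (hι : ∀ (w : InfinitePlace K) (d : 𝓞 K), d ∈ v.asIdeal ↔ ‖ι.symm (w.embedding (d : K))‖ < 1)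
    {S : Finset (HeightOneSpectrum (𝓞 K))} (hvbS : vbar ∉ S) {lam : HeckeCharacter K} {kl jl : ℤ}
    (hlam : lam.HasInfinityType (fun _ ↦ kl) (fun _ ↦ jl))
    (hlamS : ∀ w : HeightOneSpectrum (𝓞 K), w ∉ S → lam.IsUnramifiedAt w)
    {κ₁ κ₂ : ZpExtension K p} {γ₁ γ₂ : absoluteGaloisGroup K}
    (hpair : ZpExtension.IsUnitGeneratorPair κ₁ κ₂ γ₁ γ₂)
    {Ω δ Ω' δ' : ℂ} {Ωp Ωp' : ℂ_[p]}
    (hΩ : Ω ≠ 0) (hδ : δ ≠ 0) (hΩp : Ωp ≠ 0) (hΩ' : Ω' ≠ 0) (hδ' : δ' ≠ 0) (hΩp' : Ωp' ≠ 0)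
    (hex : ∃ (G₀ Gc₀ : PowerSeries (PowerSeries (PadicComplexInt p))) (C : ℂ_[p]) (g : absoluteGaloisGroup K),
      G₀ ≠ 0 ∧ IsKatzMeasure₂ ι v vbar S κ₁ κ₂ γ₁ γ₂ lam Ω δ Ωp G₀ ∧
      IsKatzMeasure₂ ι v vbar (S.image fun w ↦ IsCMField.complexConj K • w) κ₁ κ₂ γ₁ γ₂ (reflect lam) Ω δ Ωp Gc₀ ∧
      ‖C‖ = 1 ∧
      ∀ (r r₂ : FramedGaloisRep K (PadicAlgCl p) 1),
        FactorsThroughPair κ₁ κ₂ r → FactorsThroughPair κ₁ κ₂ r₂ → IsConjInverse r r₂ →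
        ∀ x : ℂ_[p],
          IntSeries.HasValueAt₂ Gc₀ (avatarValueAt r₂ γ₁ - 1) (avatarValueAt r₂ γ₂ - 1) x →
          IntSeries.HasValueAt₂ G₀ (avatarValueAt r γ₁ - 1) (avatarValueAt r γ₂ - 1) (C * avatarValueAt r g * x))
    {G' : PowerSeries (PowerSeries (PadicComplexInt p))}
    (hG' : IsKatzMeasure₂ ι v vbar S κ₁ κ₂ γ₁ γ₂ lam Ω' δ' Ωp' G') :
    ∃ (Gc' : PowerSeries (PowerSeries (PadicComplexInt p))) (C' : ℂ_[p]) (g' : absoluteGaloisGroup K),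
      IsKatzMeasure₂ ι v vbar (S.image fun w ↦ IsCMField.complexConj K • w) κ₁ κ₂ γ₁ γ₂ (reflect lam) Ω' δ' Ωp' Gc' ∧
      ‖C'‖ = 1 ∧
      ∀ (r r₂ : FramedGaloisRep K (PadicAlgCl p) 1),
        FactorsThroughPair κ₁ κ₂ r → FactorsThroughPair κ₁ κ₂ r₂ → IsConjInverse r r₂ →
        ∀ x : ℂ_[p],
          IntSeries.HasValueAt₂ Gc' (avatarValueAt r₂ γ₁ - 1) (avatarValueAt r₂ γ₂ - 1) x →
          IntSeries.HasValueAt₂ G' (avatarValueAt r γ₁ - 1) (avatarValueAt r γ₂ - 1) (C' * avatarValueAt r g' * x) := by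
  obtain ⟨u₁, u₂, htop⟩ := exists_isTopGeneratorPair_unitTwist hpair
  simp only [← PrintCf2.KatzUniqueTransport.isKatzMeasure₂_unitTwist_iff κ₁ κ₂ u₁ u₂,
    ← PrintCf2.KatzUniqueTransport.factorsThroughPair_unitTwist_iff κ₁ κ₂ u₁ u₂] at hex hG' ⊢
  exact thmII64_conclusion_at_every_period_of_exists hK hv hvbar hne hι hvbS hlam hlamS htop hΩ hδ hΩp hΩ' hδ' hΩp' hex hG'

end Summit.BirchSwinnertonDyer.BirchSwinnertonDyer.Theorems.GoodLatticeThmII64PeriodAxis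

end
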